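import Literature.NumberTheory.EllipticCurves.NeronLocalHeightBadPlacesProofs
import Literature.NumberTheory.EllipticCurves.LangHeightNonarchEstimate
import HarnessLib

/-!
# Petsche's Lemma 3 over `ℚ`: transport to the local minimal model, and the case `c_v = 1`

Pure proofs (theorems only) in topic `NumberTheory/EllipticCurves` (family `abc`, G06), for the
named fact `Literature.NumberTheory.EllipticCurves.Petsche2006_lemma3` (`LangHeightNonarchEstimate.lean`;
C. Petsche, *Small rational points on elliptic curves over number fields*, New York J. Math. 12
(2006), Lemma 3: `Λ_v(Z) ≥ (1/c_v² − 1/N)(1/12) log|1/Δ_v|_v` for `N` distinct points at a finite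
place `v`), the last remaining input of the formal proof of Petsche's Theorem 2 over `ℚ`
(`Petsche2006_langHeightLowerBound_of_lemma3`, `LangHeightKodairaNeronProofs.lean`).

The fact is stated for Tate's `λ_v` (`neronLocalHeight (padicAbv v)`) on the rational points of an
arbitrary Weierstrass equation `W` over `ℚ`, while its proof runs on the minimal equation at `v`
over the completion. This file packages the transport, all of whose ingredients are theorems of the
tree (`NeronLocalHeightBadPlacesProofs.lean` and its imports), and settles the places with trivial
component group:

* `exists_transport_localMinimalModel` — there is an injective homomorphism
  `T : W(ℚ) →+ E(ℚ_v)`, `E = W.localMinimalModel v`, along which Tate's series is preserved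
  (`λ_E(TQ) = λ_v(Q)` for `Q ≠ O`: ATAEC VI.1.1(c), `neronLocalHeight_baseChange`, and VI.1.1(b),
  `neronLocalHeight_pointMap`) and such that `λ_v(Q) ≥ (1/12) ord_v(Δ_min) log p_v` whenever
  `TQ ∈ E₀(ℚ_v)` (ATAEC VI.4.1 on the identity component,
  `le_neronLocalHeight_of_hasNonsingularReduction`, with `log ‖Δ_E‖ = −ord_v(Δ_min) log p_v`);
* `Petsche2006.lemma3_at_of_tamagawaNumberAt_eq_one` — **Lemma 3 at every place with `c_v = 1`**
  (good reduction, `I₁`, non-split `Iₙ` with `n` odd, and the additive types `II`, `II*` and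
  `IV`, `IV*`, `I₀*` when their component group has no rational point): then `E₀(ℚ_v) = E(ℚ_v)`,
  every difference `P − Q` of distinct rational points has `λ_v(P − Q) ≥ (1/12) log|1/Δ_v|_v`,
  and `Λ_v(Z) ≥ (1 − 1/N)(1/12) log|1/Δ_v|_v`, which is Petsche's bound with `c_v = 1` (his
  display (15) summed over all `N(N − 1)` ordered pairs; the `j_v`-part plays no role).

The places with `c_v ≥ 2` need, in addition, the description of `λ_v` off the identity component
(the local-analytic half of Petsche's proof); the counting half is `Petsche2006.lemma3_counting`
(`LangHeightLemma3CountingProofs.lean`).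

## References

* C. Petsche, *Small rational points on elliptic curves over number fields*, New York J. Math. 12
  (2006), 257–268 (arXiv math/0508160): Lemma 3 and its proof, display (15).
* J. H. Silverman, *Advanced Topics in the Arithmetic of Elliptic Curves*, GTM 151 (1994):
  Thm. VI.1.1(b),(c), Thm. VI.4.1.

## Design

Theorems only; the transport is packaged as an existence statement so that later files need not
repeat the `let`-bindings of `le_neronLocalHeight_twelve_nsmul_of_not_hasSplitMultiplicativeReductionAt_holds`,
whose construction is followed verbatim.
-/

noncomputable section

open scoped Classical

open IsDedekindDomain

/-! ### ATAEC Thm. VI.4.1 on `E₀(K)` for a minimal equation over a discrete valuation ring -/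

namespace WeierstrassCurve.Affine.Point

section Local

open Literature.NumberTheory.EllipticCurves

variable {K : Type*} [Field K] {Γ₀ : Type*} [LinearOrderedCommGroupWithZero Γ₀]
  {w : Valuation K Γ₀} {R : Type*} [CommRing R] [IsDomain R] [IsDiscreteValuationRing R]
  [Algebra R K] [IsFractionRing R K] (hw : w.Integers R) {v : AbsoluteValue K ℝ}
  (hna : IsNonarchimedean v) (hvw : ∀ x : K, v x ≤ 1 ↔ w x ≤ 1)
include hw hna hvw

/-- **ATAEC Thm. VI.4.1 on the good-reduction subgroup.** For a discrete valuation ring `R` with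
fraction field `K` (the ring of a valuation `w`), a nonarchimedean absolute value `|·|` on `K` with
the same unit ball, an `R`-minimal Weierstrass equation `E` and a point `P ∈ E₀(K)`
(`WeierstrassCurve.goodReductionSubgroup`, Silverman AEC VII.2.1):
`λ(P) ≥ (1/12) v(Δ_E) = −(1/12) log|Δ_E|` (Silverman ATAEC Thm. VI.4.1,
`le_neronLocalHeight_of_hasNonsingularReduction`; the variant of
`le_neronLocalHeight_nsmul_of_index_dvd` with the membership as hypothesis).
[cite: Silverman1994, Thm VI.4.1] -/
theorem le_neronLocalHeight_of_mem_goodReductionSubgroup (E : WeierstrassCurve K) [E.IsMinimal R]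
    {P : E.toAffine.Point} (hP : P ∈ E.goodReductionSubgroup R) :
    -(1 / 12 * Real.log (v E.Δ)) ≤ neronLocalHeight v P := by
  obtain ⟨W₀, rfl⟩ : ∃ W₀ : WeierstrassCurve R, E = W₀.baseChange K :=
    WeierstrassCurve.IsIntegral.integral
  have hns : (W₀.baseChange K).IsNonsingularReductionPoint R P :=
    (WeierstrassCurve.mem_goodReductionSubgroup_iff_holds R (W₀.baseChange K) P).mp hP
  have hP' : W₀.HasNonsingularReduction P :=
    (WeierstrassCurve.isNonsingularReductionPoint_iff_hasNonsingularReduction R W₀ _).mp hns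
  exact le_neronLocalHeight_of_hasNonsingularReduction hw hna hvw hP'

end Local

end WeierstrassCurve.Affine.Point

namespace Literature.NumberTheory.EllipticCurves

open Rat.HeightOneSpectrum _root_.WeierstrassCurve _root_.WeierstrassCurve.Affine.Point Petsche2006

/-! ### The transport `W(ℚ) →+ E(ℚ_v)` to the local minimal model -/

/-- **Transport of rational points to the local minimal model, with Tate's `λ`.** For an elliptic
curve `W/ℚ` and a prime `v`, let `E = W.localMinimalModel v` over `ℚ_v ⊃ O_v`. There is an
injective homomorphism `T : W(ℚ) →+ E(ℚ_v)` (base change to `ℚ_v` followed by the change of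
variables to the minimal model) such that (i) `λ_E(TQ) = λ_v(Q)` for every `Q ≠ O`, where `λ_E` is
Tate's series for `E` and the norm of `ℚ_v` and `λ_v = neronLocalHeight (padicAbv v)` (Silverman,
ATAEC Thm. VI.1.1(c) and (b): `neronLocalHeight_baseChange`, `neronLocalHeight_pointMap`), and
(ii) `λ_v(Q) ≥ (1/12) ord_v(Δ_min) log p_v` whenever `Q ≠ O` and `TQ ∈ E₀(ℚ_v)`
(ATAEC Thm. VI.4.1, `le_neronLocalHeight_of_hasNonsingularReduction`, with
`log ‖Δ_E‖ = −ord_v(Δ_min) log p_v`, `log_norm_Δ_localMinimalModel`).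
[cite: Silverman1994, Thm VI.1.1] -/
theorem exists_transport_localMinimalModel (W : WeierstrassCurve ℚ) [W.IsElliptic]
    (v : HeightOneSpectrum ℤ) :
    ∃ T : W.toAffine.Point →+ (W.localMinimalModel v).toAffine.Point,
      Function.Injective T ∧
      (∀ Q : W.toAffine.Point, Q ≠ 0 →
        neronLocalHeight (NormedField.toAbsoluteValue (v.adicCompletion ℚ)) (T Q) =
          Q.neronLocalHeight (padicAbv v)) ∧
      (∀ Q : W.toAffine.Point, Q ≠ 0 →
        T Q ∈ (W.localMinimalModel v).goodReductionSubgroup (v.adicCompletionIntegers ℚ) →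
          1 / 12 * ((W.ordMinimalDiscriminant v : ℝ) * Real.log (natGenerator v)) ≤
            Q.neronLocalHeight (padicAbv v)) := by
  haveI hp : Fact (natGenerator v).Prime := ⟨prime_natGenerator v⟩
  haveI := W.isElliptic_localMinimalModel v
  let Kv := v.adicCompletion ℚ
  let Ov := v.adicCompletionIntegers ℚ
  let abv : AbsoluteValue Kv ℝ := NormedField.toAbsoluteValue Kv
  let E' : WeierstrassCurve Kv := W.baseChange Kv
  let C : VariableChange Kv := (E'.exists_isMinimal Ov).choose
  -- `W.localMinimalModel v = C • E'` by definition (`WeierstrassCurve.minimal`)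
  let ι : W.toAffine.Point →+ E'.toAffine.Point := Affine.Point.baseChange (W' := W) ℚ Kv
  have hι : ∀ {x y : ℚ} (h : W.toAffine.Nonsingular x y),
      ∃ h', ι (some x y h) = some (algebraMap ℚ Kv x) (algebraMap ℚ Kv y) h' :=
    fun _ => ⟨_, rfl⟩
  have hv : ∀ x : ℚ, abv (algebraMap ℚ Kv x) = padicAbv v x :=
    toAbsoluteValue_adicCompletion_algebraMap v
  have hιinj : Function.Injective ι := Affine.Point.map_injective (Algebra.ofId ℚ Kv)
  -- the transport, typed on `W.localMinimalModel v` (definitionally `C • E'`)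
  let T : W.toAffine.Point →+ (W.localMinimalModel v).toAffine.Point :=
    (VariableChange.pointEquiv E' C).toAddMonoidHom.comp ι
  have h2 : (2 : Kv) ≠ 0 := by
    rw [← map_ofNat (algebraMap ℚ Kv) 2]
    exact (map_ne_zero_iff _ (algebraMap ℚ Kv).injective).mpr two_ne_zero
  -- `λ_E(TQ) = λ_{E'}(ιQ) = λ_v(Q)` (ATAEC VI.1.1(b) and (c))
  have hlam : ∀ Q : W.toAffine.Point, Q ≠ 0 →
      neronLocalHeight abv (T Q) = Q.neronLocalHeight (padicAbv v) := by
    intro Q hQ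
    have hιQ : ι Q ≠ 0 := fun h => hQ (hιinj (h.trans (map_zero ι).symm))
    have e : neronLocalHeight abv (T Q) =
        neronLocalHeight abv (VariableChange.pointMap E' C (ι Q)) := rfl
    refine e.trans ?_
    rw [neronLocalHeight_pointMap abv C h2 hιQ, neronLocalHeight_baseChange ι hι hv]
  refine ⟨T, ?_, hlam, ?_⟩
  · intro P Q hPQ
    apply hιinj
    apply (VariableChange.pointEquiv E' C).injective
    exact hPQ
  · intro Q hQ hmem
    -- ATAEC VI.4.1 on `E₀(ℚ_v)` for the minimal model
    have hloc : -(1 / 12 * Real.log (abv (W.localMinimalModel v).Δ)) ≤ neronLocalHeight abv (T Q) :=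
      le_neronLocalHeight_of_mem_goodReductionSubgroup (integers_adicCompletionIntegers_int v)
        (isNonarchimedean_toAbsoluteValue_adicCompletion v)
        (toAbsoluteValue_adicCompletion_le_one_iff v) (W.localMinimalModel v) hmem
    have hΔ : Real.log (abv (W.localMinimalModel v).Δ) =
        -((W.ordMinimalDiscriminant v : ℝ) * Real.log (natGenerator v)) :=
      log_norm_Δ_localMinimalModel v W
    rw [← hlam Q hQ]
    rw [hΔ] at hloc
    linarith

/-! ### Lemma 3 at the places with `c_v = 1` -/

/-- **Petsche 2006, Lemma 3, at a finite place of `ℚ` with trivial component group** (`c_v = 1`: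
good reduction, split `I₁`, non-split `Iₙ` with `n` odd, the additive types whose rational component
group is trivial). Then `E₀(ℚ_v) = E(ℚ_v)` for the local minimal model, so by ATAEC Thm. VI.4.1
every difference of two distinct rational points satisfies
`λ_v(P − Q) ≥ (1/12) ord_v(Δ_min) log p_v = (1/12) log|1/Δ_v|_v` (the inequality behind
Petsche's display (15), here for `λ_v` itself since all differences lie in `E₀(ℚ_v)`), and summing
over the `N(N − 1)` ordered pairs,
`Λ_v(Z) ≥ (1 − 1/N)(1/12) log|1/Δ_v|_v = (1/c_v² − 1/N)(1/12) log|1/Δ_v|_v`.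
[cite: Petsche2006, Lemma 3] -/
theorem Petsche2006.lemma3_at_of_tamagawaNumberAt_eq_one (W : WeierstrassCurve ℚ) [W.IsElliptic]
    (v : HeightOneSpectrum ℤ) (hc : W.tamagawaNumberAt v = 1) (Z : Finset W.toAffine.Point)
    (hZ : Z.Nonempty) :
    (1 / (W.tamagawaNumberAt v : ℝ) ^ 2 - 1 / (Z.card : ℝ)) *
        (1 / 12 * ((W.ordMinimalDiscriminant v : ℝ) * Real.log (natGenerator v))) ≤
      localHeightDiscSum (padicAbv v) Z := by
  obtain ⟨T, hTinj, -, hE₀⟩ := exists_transport_localMinimalModel W v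
  -- `c_v = 1`: the good-reduction subgroup is everything
  have htop : (W.localMinimalModel v).goodReductionSubgroup (v.adicCompletionIntegers ℚ) = ⊤ := by
    rw [← AddSubgroup.index_eq_one]
    exact hc
  set L : ℝ := 1 / 12 * ((W.ordMinimalDiscriminant v : ℝ) * Real.log (natGenerator v)) with hL
  have hpair : ∀ P ∈ Z, ∀ Q ∈ Z.erase P, L ≤ (P - Q).neronLocalHeight (padicAbv v) := by
    intro P _ Q hQ
    have hPQ : P - Q ≠ 0 := sub_ne_zero.mpr (Finset.ne_of_mem_erase hQ).symm
    exact hE₀ (P - Q) hPQ (by rw [htop]; exact AddSubgroup.mem_top _)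
  -- sum over the `N(N-1)` ordered pairs
  set N : ℝ := (Z.card : ℝ) with hN
  have hNpos : 0 < N := by rw [hN]; exact_mod_cast hZ.card_pos
  have hsum : N * (N - 1) * L ≤ ∑ P ∈ Z, ∑ Q ∈ Z.erase P, (P - Q).neronLocalHeight (padicAbv v) := by
    have hrow : ∀ P ∈ Z, (N - 1) * L ≤ ∑ Q ∈ Z.erase P, (P - Q).neronLocalHeight (padicAbv v) := by
      intro P hP
      have hcard : ((Z.erase P).card : ℝ) = N - 1 := by
        rw [Finset.card_erase_of_mem hP, Nat.cast_sub (Finset.card_pos.mpr ⟨P, hP⟩), Nat.cast_one]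
      calc (N - 1) * L = ∑ Q ∈ Z.erase P, L := by
            rw [Finset.sum_const, nsmul_eq_mul, hcard]
        _ ≤ ∑ Q ∈ Z.erase P, (P - Q).neronLocalHeight (padicAbv v) :=
            Finset.sum_le_sum fun Q hQ => hpair P hP Q hQ
    calc N * (N - 1) * L = ∑ P ∈ Z, (N - 1) * L := by
          rw [Finset.sum_const, nsmul_eq_mul, ← hN]
          ring
      _ ≤ _ := Finset.sum_le_sum hrow
  rw [localHeightDiscSum, hc, Nat.cast_one, one_pow, ← hN]
  rw [show (1 / (1 : ℝ) - 1 / N) * L = 1 / N ^ 2 * (N * (N - 1) * L) by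
    field_simp]
  exact mul_le_mul_of_nonneg_left hsum (by positivity)

end Literature.NumberTheory.EllipticCurves

end
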